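import Summits.BirchSwinnertonDyer.Rank1Residual.ManinAdditive.CuspidalKummerUFamily
import HarnessLib
import HarnessLib.Audit.Tags

/-!
# E-an-146 `BlindQuadraticResidueFour`: the blind quadratic residue law `c − β² = ±4` (c-free census law) — typed
# (cell `bsd-f2-manin`, seat -an gen 32, MEMO-an §75; TURNKEY-an-21 §5; typer g17)

TYPER NOTE.  SOURCE = HOME/an/g32/Sketch-an-g32.lean sha16 d292290bfb969dc5, §5 VERBATIM (namespace `…ManinAdditive.CuspidalKummer`, sibling of
`CuspidalKummerUFamily.lean`); BC7 CLEAN (Sketch-an-g32.bc7.txt dabf1ab2bc3facc3).  One `@[conjecture]` census law (nothing asserted) + two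
PROVED sanity lemmas.  BC5: HOME/an/g32/blind_census.out 86a231102f868176 — over every optimal class `4 ∣ N ≤ 5·10⁵`: 94 blind (class, root)
instances, `c′ = 4` ×89 (the `u`-family, E-an-50♯), `c′ = −4` ×5 (24a1, 40a1, 48a1, 64a1, 80a1), nothing else.  REFUTER VERDICTS: R-an-56
PENDING at filing.  bears_on: stmt-BirchSwinnertonDyer-22967 (C2).
[cite: CesnaviciusNeururerSaha2023, Thm. 1.1 (shape only; the residue law is the cell's E-an-146 — MEMO-an §75, NOT in print)]
-/

noncomputable section

open scoped MatrixGroups ModularForm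

open CongruenceSubgroup WeierstrassCurve
  Literature.NumberTheory.DiophantineGeometry
  Literature.NumberTheory.EllipticCurves
  Literature.NumberTheory.EllipticCurves.ModularForms

namespace Summit.BirchSwinnertonDyer.Rank1Residual.ManinAdditive

/-! ## §5 E-an-146: the blind quadratic residue law `c − β² = ±4` (c-free census law) -/

namespace CuspidalKummer

/-- **Candidate E-an-146 `BlindQuadraticResidueFour` (census LAW, c-free, decidable per curve; cell bsd-f2-manin, an g32,
MEMO-an §75; nothing asserted).**  Write the 2-torsion cubic of an `X₀(N)`-optimal `W` (`4 ∣ N`, `a₁ = a₃ = 0`) at an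
integer root `e` as `(x − e)((x + β)² + c′)` (`a₂ + e = 2β`, `c′ = a₄ + 2βe − β²`; Kummer-blind ⟺ `2 ∣ a₂ + e` and
`4 ∣ c′`).  LAW: if `e` is Kummer-blind then `c′ = ±4` EXACTLY.  Census (every optimal class `4 ∣ N ≤ 5·10⁵`,
g32/blind_census.out): 94 blind (class, root) instances, `c′ = 4` ×89 (the `u`-family, E-an-50♯) and `c′ = −4` ×5
(24a1, 40a1, 48a1, 64a1, 80a1); no other value.  Why it might fail: an optimal curve beyond `5·10⁵` with a blind root and
`8 ∣ c′` (e.g. a large-`|c′|` analogue of 24a1); the law is a rigidity statement about OPTIMAL curves only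
(`y² = x(x² + 8)` is blind with `c′ = 8` but not `X₀`-optimal). -/
@[conjecture]
def BlindQuadraticResidueFour : Prop :=
  ∀ (W : WeierstrassCurve ℚ) [W.IsElliptic] [W.IsGloballyMinimal] {N : ℕ} [NeZero N]
    (D : ModularParametrizationData W N),
    (∀ z ∈ D.L.lattice, ∃ w ∈ periodLattice D.f, z = D.c * w) → 4 ∣ N →
    ∀ (a₂ a₄ e β : ℤ), W.a₁ = 0 → W.a₃ = 0 → W.a₂ = a₂ → W.a₄ = a₄ →
    W.twoTorsionPolynomial.toPoly.IsRoot (e : ℚ) → KummerBlindAtTwo a₂ a₄ e → a₂ + e = 2 * β →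
    a₄ + 2 * β * e - β ^ 2 = 4 ∨ a₄ + 2 * β * e - β ^ 2 = -4

/-- Sanity (PROVED): on the `u`-family the blind root `e = −(s+u)` has `β = s` and `c′ = 4`. -/
theorem uFamily_quadraticResidue_eq_four (u s : ℤ) :
    (3 * s ^ 2 + 2 * s * u + 4) + 2 * s * (-(s + u)) - s ^ 2 = 4 := by
  ring

/-- Sanity (PROVED): Kummer-blindness at a root with `a₂ + e = 2β` is EXACTLY `4 ∣ c′` (so E-an-146 says the blind
residue `c′/4` is a unit `±1`). -/
theorem kummerBlindAtTwo_iff_four_dvd (a₂ a₄ e β : ℤ) (hβ : a₂ + e = 2 * β) :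
    KummerBlindAtTwo a₂ a₄ e ↔ (4 : ℤ) ∣ a₄ + 2 * β * e - β ^ 2 := by
  unfold KummerBlindAtTwo
  rw [hβ]
  constructor
  · rintro ⟨-, k, hk⟩
    exact ⟨-k, by linarith⟩
  · rintro ⟨k, hk⟩
    exact ⟨⟨β, two_mul β⟩, -k, by linear_combination (-4 : ℤ) * hk⟩

end CuspidalKummer

end Summit.BirchSwinnertonDyer.Rank1Residual.ManinAdditive
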